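import Summits.QuantumFields.BalabanUV.Beta.SymmetrisedDressingLegs

/-!
# `BalabanUV.Beta.SymmetrisedDressingDress` — the SYMMETRISED dressing functor `dressSymAt : JetData → JetData` (bond slot + both field legs
# dressed by `Π^{sym}_bm`), its localisation constants and block-translation laws (β sub-cell, row D1 OWNER b2b-balaban-beta-an2, gen 26;
# K5b of the «JsB12Sym» wiring: decl-by-decl twin of `AxialDressingRootedBmDress` with `Π_bm ↦ Π^{sym}_bm`)

HONEST FRAMING (cell charter, verbatim): «discharging BetaPertH makes Balaban's UV stability UNCONDITIONAL — a real
constructive-QFT result; it is NOT the continuum limit and NOT the Clay problem.»  DERIVED cell leaf; no statement of Bałaban's papers, no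
`[cite:]` tag, no `Prop` fact; instantiates no wall binder.  NOT D1, NOT `BetaPertH`; NOT continuum; NOT Clay.
HONEST DEPENDENCY: continuum YM on T⁴ ⇐ BetaPertH ∧ nine spine estimates (0/9 proved); BetaPertH ⇐ (D1) ∧ (D4) ∧ CAP+tail;
G-an2-4 gates asym, D1 and NE2/3/4.

## What is here (twins of `AxialDressingRootedBmDress` §4–§6; the constants `cWb`, `cKb`, `cKb'` of the comb files are REUSED by name)
* §4 the bond slot `coProjSymAtK` (`Πᵀ^{sym}_bm` on an `MKer`-valued stencil family), `locStencil_coProjSymAtK`, `locStencil_dressKSymAt`.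
* §5 block translation: `dressKSymAt_shiftK`, `coProjSymAtK_shiftK`, `dressSymAtS_translate`, `dressSymAtW_translate`.
* §6 [our object] **`dressSymAt hr J`** — the symmetrised-dressed jet datum (S-slot: `dressKSymAt ∘ coProjSymAtK`; W: `dressKSymAt`; same rate;
  constants `cK²·cK'·Cs`, `cK²·Cw` with the comb's `cKb`/`cKb'`), `dressSymAt_S/W/δ/Cs/Cw`, and the centred `dressSymCtr`.
All declarations `[folklore]`/[our object]; axioms standard.  Provenance: b2b-balaban β sub-cell, unit beta-an2 gen 26, 2026-08-21.
-/

open Finset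
open scoped BigOperators
open Literature.MathematicalPhysics.QuantumFieldTheory
open Literature.MathematicalPhysics.QuantumFieldTheory.Balaban1983to89
open Literature.MathematicalPhysics.QuantumFieldTheory.Balaban1983to89.Beta
open B12Sec2to5 (l1 l1_nonneg)
open ExpKernelCalculus (MKer Decays BiLoc comp tr shiftK l1_sub_triangle l1_sub_symm)
open AffineAveraging (Form0 Form1 box toSite unitVec unitVec_apply)
open AveragingContoursRooted (ctrOff ctrOff_mem_box)
open AxialDressing (exp_recenter_le)
open OneStepResolventKernel (Fib LocStencil JetData)
open Summit.QuantumFields.BalabanUV.Beta.TameKernelCalculus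
open Summit.QuantumFields.BalabanUV.Beta.AxialDressingRooted
open Summit.QuantumFields.BalabanUV.Beta.SymmetrisedDressingMatrix
open Summit.QuantumFields.BalabanUV.Beta.SymmetrisedDressingKernel
open Summit.QuantumFields.BalabanUV.Beta.SymmetrisedDressingLegs

namespace Summit.QuantumFields.BalabanUV.Beta.SymmetrisedDressingDress

noncomputable section

variable {d : ℕ}

/-! ## §4 The bond slot: `Πᵀ_bm` on the `MKer`-valued stencil family -/

section BondSlot

/-- [folklore] `Πᵀ_bm` on an `MKer`-valued bond family, entrywise: `(Πᵀ_bm S) κ u x y a b := Πᵀ_bm (S · · x y a b) κ u`. -/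
def coProjSymAtK (ρ : Fin (d + 1) → ℤ) (N : ℕ)
    (S : Fin (d + 1) → (Fin (d + 1) → ℤ) → MKer (d + 1) (Fib d)) :
    Fin (d + 1) → (Fin (d + 1) → ℤ) → MKer (d + 1) (Fib d) :=
  fun κ u x y a b => coProjSymAt ρ N (fun κ' u' => S κ' u' x y a b) κ u

/-- [folklore] Evaluation at a kernel entry commutes with `Πᵀ_bm` (by definition). -/
theorem coProjSymAtK_eval (ρ : Fin (d + 1) → ℤ) (N : ℕ)
    (S : Fin (d + 1) → (Fin (d + 1) → ℤ) → MKer (d + 1) (Fib d))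
    (κ : Fin (d + 1)) (u x y : Fin (d + 1) → ℤ) (a b : Fib d) :
    coProjSymAtK ρ N S κ u x y a b = coProjSymAt ρ N (fun κ' u' => S κ' u' x y a b) κ u := rfl





/-- [folklore] **THE BLOCK-MEAN BOND-SLOT DRESSING PRESERVES `LocStencil`:** `LocStencil S Cs δ ⇒ LocStencil (Πᵀ_bm S) (cKb'·Cs) δ`. -/
theorem locStencil_coProjSymAtK {N : ℕ} (hN : 1 ≤ N) {r : Fin (d + 1) → ℕ} (hr : r ∈ box (d + 1) N)
    {S : Fin (d + 1) → (Fin (d + 1) → ℤ) → MKer (d + 1) (Fib d)} {Cs δ : ℝ}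
    (hS : LocStencil S Cs δ) (hδ : 0 ≤ δ) : LocStencil (coProjSymAtK (toSite r) N S) (cKb' d N δ * Cs) δ := by
  have hC : 0 ≤ Cs := (hS 0 0).nonneg (Sum.inl 0)
  intro κ u x y a b
  rw [coProjSymAtK_eval]
  have hM : ∀ (κ' : Fin (d + 1)) (v : Fin (d + 1) → ℤ), v ∈ cube (d + 1) N →
      |S κ' (u + v) x y a b| ≤ Cs * Real.exp (2 * δ * (((d : ℝ) + 1) * N)) * Real.exp (-δ * (l1 (x - u) + l1 (y - u))) := by
    intro κ' v hv
    have hr' : l1 ((u + v) - u) ≤ ((d : ℝ) + 1) * N := by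
      rw [add_sub_cancel_left]
      have h := l1_le_of_mem_cube hv
      push_cast at h
      exact h
    have tx : l1 (x - u) ≤ l1 (x - (u + v)) + l1 ((u + v) - u) := l1_sub_triangle x (u + v) u
    have ty : l1 (y - u) ≤ l1 (y - (u + v)) + l1 ((u + v) - u) := l1_sub_triangle y (u + v) u
    calc |S κ' (u + v) x y a b| ≤ Cs * Real.exp (-δ * (l1 (x - (u + v)) + l1 (y - (u + v)))) := hS κ' (u + v) x y a b
      _ ≤ Cs * (Real.exp (2 * δ * (((d : ℝ) + 1) * N)) * Real.exp (-δ * (l1 (x - u) + l1 (y - u)))) := by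
          refine mul_le_mul_of_nonneg_left ?_ hC
          rw [← Real.exp_add]
          exact Real.exp_le_exp.2 (by nlinarith)
      _ = Cs * Real.exp (2 * δ * (((d : ℝ) + 1) * N)) * Real.exp (-δ * (l1 (x - u) + l1 (y - u))) := by ring
  calc |coProjSymAt (toSite r) N (fun κ' u' => S κ' u' x y a b) κ u|
      ≤ cWb d N * (Cs * Real.exp (2 * δ * (((d : ℝ) + 1) * N)) * Real.exp (-δ * (l1 (x - u) + l1 (y - u)))) :=
        abs_coProjSymAt_le hN hr _ κ u hM
    _ = cKb' d N δ * Cs * Real.exp (-δ * (l1 (x - u) + l1 (y - u))) := by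
        unfold cKb'
        ring

/-- [folklore] `LocStencil` survives the full block-mean kernel dressing of every stencil value as well. -/
theorem locStencil_dressKSymAt {N : ℕ} (hN : 1 ≤ N) {r : Fin (d + 1) → ℕ} (hr : r ∈ box (d + 1) N)
    {S : Fin (d + 1) → (Fin (d + 1) → ℤ) → MKer (d + 1) (Fib d)} {Cs δ : ℝ}
    (hS : LocStencil S Cs δ) (hδ : 0 ≤ δ) :
    LocStencil (fun κ u => dressKSymAt (toSite r) N (S κ u)) (cKb d N δ * (cKb d N δ * Cs)) δ :=
  fun κ u => biLoc_dressKSymAt hN hr (hS κ u) hδ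

end BondSlot

/-! ## §5 Coarse-translation covariance; the `covS` / `covW` sockets -/

section ShiftBm

/-- [folklore] **THE BLOCK-MEAN KERNEL DRESSING COMMUTES WITH COARSE SHIFTS.** -/
theorem dressKSymAt_shiftK (ρ : Fin (d + 1) → ℤ) {N : ℕ} (hN : 1 ≤ N) (K : MKer (d + 1) (Fib d)) (t : Fin (d + 1) → ℤ) :
    dressKSymAt ρ N (shiftK (-((N : ℤ) • t)) K) = shiftK (-((N : ℤ) • t)) (dressKSymAt ρ N K) := by
  unfold dressKSymAt
  rw [← ExpKernelCalculus.comp_shiftK, ← ExpKernelCalculus.comp_shiftK, ← trK_shiftK, shiftK_piKSymBm ρ hN]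

/-- [folklore] `Πᵀ_bm` on an `MKer`-valued bond family commutes with a simultaneous shift of the kernel arguments. -/
theorem coProjSymAtK_shiftK (ρ : Fin (d + 1) → ℤ) (N : ℕ)
    (S : Fin (d + 1) → (Fin (d + 1) → ℤ) → MKer (d + 1) (Fib d)) (v : Fin (d + 1) → ℤ) (κ : Fin (d + 1))
    (u : Fin (d + 1) → ℤ) :
    coProjSymAtK ρ N (fun κ' u' => shiftK v (S κ' u')) κ u = shiftK v (coProjSymAtK ρ N S κ u) :=
  rfl

/-- [folklore] **THE `covS` SOCKET SURVIVES THE BLOCK-MEAN DRESSING** (shape of `dressAtS_translate`): if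
`S κ (u + N•t) = shiftK (−N•t) (S κ u)` then `dressKSymAt ρ N (Πᵀ_bm S κ u)` obeys the same law. -/
theorem dressSymAtS_translate (ρ : Fin (d + 1) → ℤ) {N : ℕ} (hN : 1 ≤ N)
    {S : Fin (d + 1) → (Fin (d + 1) → ℤ) → MKer (d + 1) (Fib d)}
    (hS : ∀ κ u t, S κ (u + (N : ℤ) • t) = shiftK (-((N : ℤ) • t)) (S κ u))
    (κ : Fin (d + 1)) (u t : Fin (d + 1) → ℤ) :
    dressKSymAt ρ N (coProjSymAtK ρ N S κ (u + (N : ℤ) • t))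
      = shiftK (-((N : ℤ) • t)) (dressKSymAt ρ N (coProjSymAtK ρ N S κ u)) := by
  have h1 : coProjSymAtK ρ N S κ (u + (N : ℤ) • t) = coProjSymAtK ρ N (fun κ' u' => S κ' (u' + (N : ℤ) • t)) κ u := by
    funext x y a b
    exact (coProjSymAt_shift ρ hN (fun κ' u' => S κ' u' x y a b) t κ u).symm
  have h2 : (fun κ' u' => S κ' (u' + (N : ℤ) • t)) = fun κ' u' => shiftK (-((N : ℤ) • t)) (S κ' u') := by
    funext κ' u'
    exact hS κ' u' t
  rw [h1, h2, coProjSymAtK_shiftK, dressKSymAt_shiftK ρ hN]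

/-- [folklore] **THE `covW` SOCKET SURVIVES THE BLOCK-MEAN DRESSING** (shape of `dressAtW_translate`). -/
theorem dressSymAtW_translate (ρ : Fin (d + 1) → ℤ) {N : ℕ} (hN : 1 ≤ N)
    {W : Fin (d + 1) → (Fin (d + 1) → ℤ) → Fin (d + 1) → (Fin (d + 1) → ℤ) → MKer (d + 1) (Fib d)}
    (hW : ∀ μ y ν y' t, W μ (y + t) ν (y' + t) = shiftK (-((N : ℤ) • t)) (W μ y ν y'))
    (μ : Fin (d + 1)) (y : Fin (d + 1) → ℤ) (ν : Fin (d + 1)) (y' t : Fin (d + 1) → ℤ) :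
    dressKSymAt ρ N (W μ (y + t) ν (y' + t)) = shiftK (-((N : ℤ) • t)) (dressKSymAt ρ N (W μ y ν y')) := by
  rw [hW, dressKSymAt_shiftK ρ hN]

end ShiftBm

/-! ## §6 The block-mean dressing functor `dressSymAt` on `JetData` -/

section DressBm

/-- [folklore] **THE BLOCK-MEAN DRESSING FUNCTOR** `dressSymAt`: for an in-block root offset `r ∈ {0,…,N−1}^{d+1}`, `Πᵀ_bm` on the
stencil bond slot and (comp form) on both `inl`-legs of every stencil value and of every second-order table; same rate, constants
`cKb²·cKb'·Cs` and `cKb²·Cw`.  Decl-by-decl twin of `dressAt` with the block-mean-normalised projector (NOTE X-an2-42 repair (A)). -/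
def dressSymAt {N : ℕ} [NeZero N] {r : Fin (d + 1) → ℕ} (hr : r ∈ box (d + 1) N) (J : JetData d N) : JetData d N where
  S := fun κ u => dressKSymAt (toSite r) N (coProjSymAtK (toSite r) N J.S κ u)
  W := fun μ y ν y' => dressKSymAt (toSite r) N (J.W μ y ν y')
  Cs := cKb d N J.δ * (cKb d N J.δ * (cKb' d N J.δ * J.Cs))
  Cw := cKb d N J.δ * (cKb d N J.δ * J.Cw)
  δ := J.δ
  δ_pos := J.δ_pos
  loc := locStencil_dressKSymAt (one_le_of_neZero N) hr
    (locStencil_coProjSymAtK (one_le_of_neZero N) hr J.loc J.δ_pos.le) J.δ_pos.le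
  loc₂ := fun μ y ν y' => biLoc_dressKSymAt (one_le_of_neZero N) hr (J.loc₂ μ y ν y') J.δ_pos.le

/-- [folklore] The block-mean-dressed stencil family, by definition. -/
theorem dressSymAt_S {N : ℕ} [NeZero N] {r : Fin (d + 1) → ℕ} (hr : r ∈ box (d + 1) N) (J : JetData d N)
    (κ : Fin (d + 1)) (u : Fin (d + 1) → ℤ) :
    (dressSymAt hr J).S κ u = dressKSymAt (toSite r) N (coProjSymAtK (toSite r) N J.S κ u) := rfl

/-- [folklore] The block-mean-dressed second-order family, by definition. -/
theorem dressSymAt_W {N : ℕ} [NeZero N] {r : Fin (d + 1) → ℕ} (hr : r ∈ box (d + 1) N) (J : JetData d N)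
    (μ : Fin (d + 1)) (y : Fin (d + 1) → ℤ) (ν : Fin (d + 1)) (y' : Fin (d + 1) → ℤ) :
    (dressSymAt hr J).W μ y ν y' = dressKSymAt (toSite r) N (J.W μ y ν y') := rfl

/-- [folklore] The block-mean dressing keeps the localisation rate. -/
theorem dressSymAt_δ {N : ℕ} [NeZero N] {r : Fin (d + 1) → ℕ} (hr : r ∈ box (d + 1) N) (J : JetData d N) :
    (dressSymAt hr J).δ = J.δ := rfl

/-- [folklore] The constants of the block-mean dressing, by definition. -/
theorem dressSymAt_Cs {N : ℕ} [NeZero N] {r : Fin (d + 1) → ℕ} (hr : r ∈ box (d + 1) N) (J : JetData d N) :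
    (dressSymAt hr J).Cs = cKb d N J.δ * (cKb d N J.δ * (cKb' d N J.δ * J.Cs)) := rfl

/-- [folklore] The constants of the block-mean dressing, by definition. -/
theorem dressSymAt_Cw {N : ℕ} [NeZero N] {r : Fin (d + 1) → ℕ} (hr : r ∈ box (d + 1) N) (J : JetData d N) :
    (dressSymAt hr J).Cw = cKb d N J.δ * (cKb d N J.δ * J.Cw) := rfl

/-- [folklore] **THE CENTRED BLOCK-MEAN DRESSING** (Bałaban's root: the block centre, `N` odd downstream). -/
def dressSymCtr {N : ℕ} [NeZero N] (J : JetData d N) : JetData d N :=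
  dressSymAt (ctrOff_mem_box (d := d + 1) (one_le_of_neZero N)) J

/-- [folklore] `dressSymCtr` unfolds to `dressSymAt` at the centre offset. -/
theorem dressSymCtr_eq {N : ℕ} [NeZero N] (J : JetData d N) :
    dressSymCtr J = dressSymAt (ctrOff_mem_box (d := d + 1) (one_le_of_neZero N)) J := rfl

end DressBm

end

end Summit.QuantumFields.BalabanUV.Beta.SymmetrisedDressingDress
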